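import Mathlib.Analysis.SpecialFunctions.ImproperIntegrals
import Mathlib.Analysis.SpecialFunctions.Integrals.Basic
import Mathlib.Analysis.Complex.ExponentialBounds
import Mathlib.MeasureTheory.Integral.Gamma
import Mathlib.Analysis.Real.Pi.Bounds
import Literature.Analysis.FunctionSpaces.TorusAgmonLatticeSum
import HarnessLib

/-!
# The lattice sum of Agmon's inequality on `T³` with an explicit constant:
# `∑_{k ≠ 0} ρ/(μₖ(μₖ + ρ)) ≤ ρ^{1/2}/π²` for `ρ ≥ 4π²`

Analysis/FunctionSpaces support file (everything proved; no definitions, no named facts), sequel of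
`TorusAgmonLatticeSum.lean` (the same bound with an existential constant) and `TorusThetaBound.lean`.
With `μₖ = 4π²|k|²` the eigenvalues of `−Δ` on the unit torus `T³ = (ℝ/ℤ)³`, the Fourier-side
proof of **Agmon's inequality** `‖u‖²_∞ ≤ C ‖∇u‖₂ ‖Δu‖₂` (Constantin–Foias 1988, Ch. 4;
Foias–Manley–Rosa–Temam 2001, Ch. II App. A (A.29)) is Cauchy–Schwarz
`(∑_{k≠0} |ûₖ|)² ≤ (∑ₖ (μₖ + μₖ²/ρ)|ûₖ|²) · W(ρ)`, `W(ρ) = ∑_{k≠0} ρ/(μₖ(μₖ+ρ))`, with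
`ρ = ‖Δu‖₂²/‖∇u‖₂² ≥ 4π²`. The value of the constant is decided by the lattice sum `W`; the
whole-space integral `∫_{ℝ³} ρ dξ/(4π²|ξ|²(4π²|ξ|² + ρ)) = ρ^{1/2}/(4π)` is its large-`ρ`
asymptotics. Here we prove the EXPLICIT bound

`W(ρ) ≤ ρ^{1/2}/π²`  for every `ρ ≥ 4π²`  (`Torus.tsum_agmonWeight_le_sqrt_div_pi_sq`),

which yields Agmon's inequality on `T³` with the constant `2/π²`,
`‖u‖²_∞ ≤ (2/π²) ‖∇u‖₂ ‖Δu‖₂` for zero-mean fields — the constant used by Lu–Doering 2008 /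
Doering 2009 / Ayala 2014 (App. A, (A.3)) in the enstrophy-growth estimate
`dℰ/dt ≤ 27/(8π⁴ν³) ℰ³` (there the lattice sums are replaced by the corresponding integrals
without proof; this file supplies a proof with room to spare: `1/π² = (4/π)·(1/(4π))`).

Proof. As in `TorusAgmonLatticeSum`: `W(ρ) = ∫₀^∞ (1 − e^{-ρs})(Θ(s) − 1) ds` with the heat trace
`Θ(s) = ∑ₖ e^{-4π²|k|²s}` (Tonelli). Put `s₀ = π/64`.
* small times `0 < s ≤ s₀`: Jacobi's transformation (Mathlib's `Real.tsum_exp_neg_mul_int_sq`)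
  gives `∑ₙ e^{-4π²n²s} ≤ Z₀ (4πs)^{-1/2}` with `Z₀ = ∑ₙ e^{-n²/(4s₀)} = ∑ₙ e^{-16n²/π} ≤ 149/147`
  (`Torus.tsum_int_exp_neg_sq_le_of_le` and private numerics), hence
  `Θ(s) − 1 ≤ Z₀³ (4πs)^{-3/2}`, and `∫₀^∞ (1 − e^{-ρs}) s^{-3/2} ds = 2√π ρ^{1/2}`
  (private lemma, by `1 − e^{-ρs} = ∫₀^ρ s e^{-rs} dr`,
  Tonelli and `∫₀^∞ s^{-1/2} e^{-rs} ds = Γ(1/2) r^{-1/2}`), so this part is `≤ Z₀³ ρ^{1/2}/(4π)`;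
* large times `s > s₀`: `Θ(s) − 1 ≤ e^{-4π²(s − s₀)} Θ(s₀) ≤ e^{-4π²(s−s₀)} Z₀³ (4πs₀)^{-3/2}`
  and `(4πs₀)^{-3/2} = 64/π³`, so this part is `≤ Z₀³ (64/π³)/(4π²)`;
* numerics: `Z₀³ (π t + 64/π³) ≤ 4 t` for `t = ρ^{1/2} ≥ 2π` since `Z₀³ ≤ (149/147)³`.

## Mathlib / tree search

Mathlib: `Real.tsum_exp_neg_mul_int_sq` (Poisson summation for the Gaussian),
`integral_rpow_mul_exp_neg_mul_rpow` / `integrableOn_rpow_mul_exp_neg_mul_rpow` (Gamma integrals),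
`Real.Gamma_one_half_eq`, `Real.exp_one_gt_d9`, `Real.pi_gt_d6`, `Real.pi_lt_d6`,
`lintegral_lintegral_swap`, `integral_exp_mul_Ioi`, `tsum_of_nat_of_neg_add_one`,
`tsum_geometric_of_lt_one`. Tree: `Torus.tsum_agmonWeight_le` (existential constant; this file
follows its Tonelli bookkeeping), `Torus.tsum_int_exp_neg_sq_le` / `Torus.tsum_pi_prod_le_tsum_pow`
(`TorusThetaBound`), `Torus.heatCoeff*` (`TorusHeatKernel`), `Torus.lintegral_Ioc_rpow_neg_half`.

## References

* P. Constantin, C. Foias, *Navier–Stokes Equations*, Univ. Chicago Press 1988, Ch. 4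
  (Agmon's inequality on the torus through Fourier series). [ConstantinFoias1988]
* C. Foias, O. Manley, R. Rosa, R. Temam, *Navier–Stokes Equations and Turbulence*, CUP 2001,
  Ch. II App. A (A.29). [FoiasManleyRosaTemam2001]
* D. Ayala, *Extreme vortex states and singularity formation in incompressible flows*, PhD thesis,
  McMaster Univ. 2014, App. A, (A.1)–(A.3) (the constant `√2/π`). [Ayala2014Thesis]
* L. Lu, C. R. Doering, Indiana Univ. Math. J. 57 (2008) 2693–2727. [LuDoering2008]
-/

noncomputable section

open MeasureTheory Set Filter Topology Real
open scoped ENNReal NNReal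

namespace Literature.Analysis.FunctionSpaces

namespace Torus

variable {d : Type*} [Fintype d]

/-! ### Jacobi's transformation as an inequality, with a parameter -/

omit [Fintype d] in
/-- **Jacobi's transformation as an inequality, small-time version with a parameter.** For
`0 < t ≤ s₀`, `∑_{n ∈ ℤ} e^{-4π²tn²} ≤ (∑_{n ∈ ℤ} e^{-n²/(4s₀)}) · (4πt)^{-1/2}`: Poisson summation
`∑ₙ e^{-πan²} = a^{-1/2} ∑ₙ e^{-πn²/a}` (`Real.tsum_exp_neg_mul_int_sq`, `a = 4πt`) and
monotonicity of the dual Gaussian `e^{-n²/(4t)} ≤ e^{-n²/(4s₀)}` for `t ≤ s₀`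
(the case `s₀ = 1` is `Torus.tsum_int_exp_neg_sq_le`). [cite: SteinWeiss1971, Ch. VII §2 Cor. 2.6] -/
theorem tsum_int_exp_neg_sq_le_of_le {t s₀ : ℝ} (ht : 0 < t) (hts : t ≤ s₀) :
    ∑' n : ℤ, Real.exp (-(4 * π ^ 2 * t * (n : ℝ) ^ 2)) ≤
      (∑' n : ℤ, Real.exp (-((n : ℝ) ^ 2 / (4 * s₀)))) * (4 * π * t) ^ (-(1 / 2 : ℝ)) := by
  have hs₀ : 0 < s₀ := lt_of_lt_of_le ht hts
  have ha : 0 < 4 * π * t := by positivity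
  have hsum : ∀ {c : ℝ}, 0 < c → Summable fun n : ℤ => Real.exp (-(c * (n : ℝ) ^ 2)) :=
    fun hc => by simpa using summable_int_exp_neg_mul_sq_sub hc 0
  have hP := Real.tsum_exp_neg_mul_int_sq ha
  have e1 : (fun n : ℤ => Real.exp (-π * (4 * π * t) * (n : ℝ) ^ 2)) =
      fun n : ℤ => Real.exp (-(4 * π ^ 2 * t * (n : ℝ) ^ 2)) := by
    funext n; congr 1; ring
  rw [e1] at hP
  rw [hP]
  have hdual : ∑' n : ℤ, Real.exp (-π / (4 * π * t) * (n : ℝ) ^ 2) ≤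
      ∑' n : ℤ, Real.exp (-((n : ℝ) ^ 2 / (4 * s₀))) := by
    have e2 : (fun n : ℤ => Real.exp (-π / (4 * π * t) * (n : ℝ) ^ 2)) =
        fun n : ℤ => Real.exp (-((1 / (4 * t)) * (n : ℝ) ^ 2)) := by
      funext n; congr 1; field_simp
    have e3 : (fun n : ℤ => Real.exp (-((n : ℝ) ^ 2 / (4 * s₀)))) =
        fun n : ℤ => Real.exp (-((1 / (4 * s₀)) * (n : ℝ) ^ 2)) := by
      funext n; congr 1; ring
    rw [e2, e3]
    refine (hsum (by positivity)).tsum_le_tsum (fun n => ?_) (hsum (by positivity))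
    rw [Real.exp_le_exp, neg_le_neg_iff]
    have hn : 0 ≤ (n : ℝ) ^ 2 := sq_nonneg _
    have h14 : (1 : ℝ) / (4 * s₀) ≤ 1 / (4 * t) :=
      one_div_le_one_div_of_le (by positivity) (by linarith)
    exact mul_le_mul_of_nonneg_right h14 hn
  have hZ0 : 0 ≤ ∑' n : ℤ, Real.exp (-((n : ℝ) ^ 2 / (4 * s₀))) :=
    tsum_nonneg fun n => (Real.exp_pos _).le
  rw [Real.rpow_neg ha.le, one_div, mul_comm]
  exact mul_le_mul_of_nonneg_right hdual (inv_nonneg.2 (Real.rpow_nonneg ha.le _))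

/-- **Small-time bound of the heat trace, with a parameter**: for `0 < t ≤ s₀`,
`∑_{k ∈ ℤ^d} e^{-4π²|k|²t} ≤ Z₀^{#d} (4πt)^{-#d/2}`, `Z₀ = ∑_{n ∈ ℤ} e^{-n²/(4s₀)}` (product
structure of the coefficients, `Torus.tsum_pi_prod_le_tsum_pow`, and the previous lemma).
[folklore] -/
private theorem tsum_heatCoeff_le_rpow_of_le {t s₀ : ℝ} (ht : 0 < t) (hts : t ≤ s₀) :
    ∑' k : d → ℤ, heatCoeff t k ≤
      (∑' n : ℤ, Real.exp (-((n : ℝ) ^ 2 / (4 * s₀)))) ^ Fintype.card d *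
        (4 * π * t) ^ (-((Fintype.card d : ℝ) / 2)) := by
  have ha : 0 < 4 * π * t := by positivity
  set a : ℤ → ℝ := fun n => Real.exp (-(4 * π ^ 2 * t * (n : ℝ) ^ 2)) with ha_def
  have ha0 : ∀ j, 0 ≤ a j := fun j => (Real.exp_pos _).le
  have has : Summable a := by
    simpa using summable_int_exp_neg_mul_sq_sub (c := 4 * π ^ 2 * t) (by positivity) 0
  have hprod : (fun k : d → ℤ => heatCoeff t k) = fun k => ∏ i, a (k i) := by
    funext k; exact heatCoeff_eq_prod t k
  have hS0 : 0 ≤ ∑' j, a j := tsum_nonneg ha0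
  calc ∑' k : d → ℤ, heatCoeff t k = ∑' k : d → ℤ, ∏ i, a (k i) := by rw [hprod]
    _ ≤ (∑' j, a j) ^ Fintype.card d := tsum_pi_prod_le_tsum_pow ha0 has
    _ ≤ ((∑' n : ℤ, Real.exp (-((n : ℝ) ^ 2 / (4 * s₀)))) * (4 * π * t) ^ (-(1 / 2 : ℝ))) ^
          Fintype.card d :=
        pow_le_pow_left₀ hS0 (tsum_int_exp_neg_sq_le_of_le ht hts) _
    _ = (∑' n : ℤ, Real.exp (-((n : ℝ) ^ 2 / (4 * s₀)))) ^ Fintype.card d *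
          (4 * π * t) ^ (-((Fintype.card d : ℝ) / 2)) := by
        rw [mul_pow, ← Real.rpow_natCast ((4 * π * t) ^ (-(1 / 2 : ℝ))), ← Real.rpow_mul ha.le]
        congr 2
        ring

/-! ### The numerical constant `Z₀ = ∑ₙ e^{-16n²/π} ≤ 149/147` -/

omit [Fintype d] in
/-- A Gaussian sum over `ℤ` is dominated by a two-sided geometric series:
`∑_{n ∈ ℤ} e^{-cn²} ≤ (1 + e^{-c})/(1 − e^{-c})` for `c > 0` (`n² ≥ |n|`). [folklore] -/
private theorem tsum_int_exp_neg_mul_sq_le {c : ℝ} (hc : 0 < c) :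
    ∑' n : ℤ, Real.exp (-(c * (n : ℝ) ^ 2)) ≤
      (1 + Real.exp (-c)) / (1 - Real.exp (-c)) := by
  set q : ℝ := Real.exp (-c) with hq
  have hq0 : 0 ≤ q := (Real.exp_pos _).le
  have hq1 : q < 1 := by rw [hq]; exact Real.exp_lt_one_iff.2 (by linarith)
  have hgeom : HasSum (fun n : ℕ => q ^ n) (1 - q)⁻¹ := hasSum_geometric_of_lt_one hq0 hq1
  -- termwise: `e^{-cn²} ≤ q^n` on `ℕ` and `e^{-c(n+1)²} ≤ q^(n+1)`
  have hterm : ∀ m : ℕ, Real.exp (-(c * (m : ℝ) ^ 2)) ≤ q ^ m := by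
    intro m
    rw [hq, ← Real.exp_nat_mul, Real.exp_le_exp]
    have hm : (m : ℝ) ≤ (m : ℝ) ^ 2 := by
      rcases Nat.eq_zero_or_pos m with h | h
      · simp [h]
      · have : (1 : ℝ) ≤ m := by exact_mod_cast h
        nlinarith
    nlinarith
  have hf1 : ∀ n : ℕ, Real.exp (-(c * ((n : ℤ) : ℝ) ^ 2)) ≤ q ^ n := fun n => by
    simpa using hterm n
  have hf2 : ∀ n : ℕ, Real.exp (-(c * ((-(n + 1 : ℤ)) : ℝ) ^ 2)) ≤ q ^ (n + 1) := fun n => by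
    have := hterm (n + 1)
    push_cast at this ⊢
    rw [neg_sq]
    exact this
  have hs1 : Summable fun n : ℕ => Real.exp (-(c * ((n : ℤ) : ℝ) ^ 2)) :=
    Summable.of_nonneg_of_le (fun n => (Real.exp_pos _).le) hf1 hgeom.summable
  have hgeom' : HasSum (fun n : ℕ => q ^ (n + 1)) (q * (1 - q)⁻¹) := by
    simpa [pow_succ, mul_comm] using hgeom.mul_left q
  have hs2 : Summable fun n : ℕ => Real.exp (-(c * ((-(n + 1 : ℤ)) : ℝ) ^ 2)) :=
    Summable.of_nonneg_of_le (fun n => (Real.exp_pos _).le) hf2 hgeom'.summable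
  have hsplit := tsum_of_nat_of_neg_add_one (f := fun n : ℤ => Real.exp (-(c * (n : ℝ) ^ 2)))
    hs1 (by simpa using hs2)
  rw [hsplit]
  have h1 : ∑' n : ℕ, Real.exp (-(c * ((n : ℤ) : ℝ) ^ 2)) ≤ (1 - q)⁻¹ :=
    (hs1.tsum_le_tsum hf1 hgeom.summable).trans_eq hgeom.tsum_eq
  have h2 : ∑' n : ℕ, Real.exp (-(c * (((-(n + 1 : ℤ)) : ℤ) : ℝ) ^ 2)) ≤ q * (1 - q)⁻¹ := by
    have := (hs2.tsum_le_tsum hf2 hgeom'.summable).trans_eq hgeom'.tsum_eq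
    simpa using this
  have h1' : ∑' n : ℕ, Real.exp (-(c * ((n : ℤ) : ℝ) ^ 2)) ≤ (1 - q)⁻¹ := h1
  have hq1' : 0 < 1 - q := by linarith
  calc (∑' n : ℕ, Real.exp (-(c * ((n : ℤ) : ℝ) ^ 2))) +
        ∑' n : ℕ, Real.exp (-(c * ((-(n + 1 : ℤ) : ℤ) : ℝ) ^ 2))
      ≤ (1 - q)⁻¹ + q * (1 - q)⁻¹ := add_le_add h1' (by simpa using h2)
    _ = (1 + q) / (1 - q) := by field_simp

omit [Fintype d] in
/-- `e^{-5} ≤ 1/148` (from `e > 2.7182818283`). [folklore] -/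
private theorem exp_neg_five_le : Real.exp (-5) ≤ 1 / 148 := by
  have h1 : (2.7182818283 : ℝ) < Real.exp 1 := Real.exp_one_gt_d9
  have h5 : Real.exp 5 = Real.exp 1 ^ 5 := by
    rw [← Real.exp_nat_mul]; norm_num
  have hpow : (148 : ℝ) ≤ Real.exp 1 ^ 5 := by
    have h0 : (0 : ℝ) ≤ 2.7182818283 := by norm_num
    have := pow_le_pow_left₀ h0 h1.le 5
    refine le_trans ?_ this
    norm_num
  rw [Real.exp_neg, ← one_div]
  rw [h5]
  exact one_div_le_one_div_of_le (by norm_num) hpow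

omit [Fintype d] in
/-- **The constant of the small-time theta bound at `s₀ = π/64`**:
`Z₀ = ∑_{n ∈ ℤ} e^{-n²/(4s₀)} = ∑ₙ e^{-16n²/π} ≤ 149/147` (`16/π ≥ 5`, `e^{-5} ≤ 1/148`,
two-sided geometric series). [folklore] -/
private theorem tsum_int_exp_neg_sq_div_le :
    ∑' n : ℤ, Real.exp (-((n : ℝ) ^ 2 / (4 * (π / 64)))) ≤ 149 / 147 := by
  have hπ : π < 3.2 := by linarith [Real.pi_lt_d2]
  have hπ0 : 0 < π := Real.pi_pos
  -- `e^{-n²/(4s₀)} ≤ e^{-5n²}`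
  have hc : (5 : ℝ) ≤ 1 / (4 * (π / 64)) := by
    rw [le_div_iff₀ (by positivity)]
    nlinarith
  have hsum5 : Summable fun n : ℤ => Real.exp (-(5 * (n : ℝ) ^ 2)) := by
    simpa using summable_int_exp_neg_mul_sq_sub (c := 5) (by norm_num) 0
  have hsumπ : Summable fun n : ℤ => Real.exp (-((n : ℝ) ^ 2 / (4 * (π / 64)))) := by
    have := summable_int_exp_neg_mul_sq_sub (c := 1 / (4 * (π / 64))) (by positivity) 0
    refine (by simpa using this : Summable fun n : ℤ =>
      Real.exp (-(1 / (4 * (π / 64)) * (n : ℝ) ^ 2))).congr fun n => ?_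
    congr 1
    ring
  have hle : ∑' n : ℤ, Real.exp (-((n : ℝ) ^ 2 / (4 * (π / 64)))) ≤
      ∑' n : ℤ, Real.exp (-(5 * (n : ℝ) ^ 2)) := by
    refine hsumπ.tsum_le_tsum (fun n => ?_) hsum5
    rw [Real.exp_le_exp, neg_le_neg_iff]
    have hn : 0 ≤ (n : ℝ) ^ 2 := sq_nonneg _
    calc 5 * (n : ℝ) ^ 2 ≤ (1 / (4 * (π / 64))) * (n : ℝ) ^ 2 :=
          mul_le_mul_of_nonneg_right hc hn
      _ = (n : ℝ) ^ 2 / (4 * (π / 64)) := by ring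
  refine hle.trans ((tsum_int_exp_neg_mul_sq_le (by norm_num : (0 : ℝ) < 5)).trans ?_)
  have hq := exp_neg_five_le
  have hq0 : 0 < Real.exp (-5) := Real.exp_pos _
  rw [div_le_div_iff₀ (by linarith) (by norm_num)]
  nlinarith


/-! ### Large times: exponential decay off the zero mode, from a time `s₀` on -/

/-- Off the zero mode the heat coefficients decay exponentially from any time `s₀ > 0` on:
`e^{-4π²|k|²s} ≤ e^{-4π²(s-s₀)} e^{-4π²|k|²s₀}` for `s ≥ s₀`, `k ≠ 0` (`|k|² ≥ 1`; the case
`s₀ = 1` is `Torus.heatCoeff_le_exp_mul`). [folklore] -/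
private theorem heatCoeff_le_exp_mul_of_le {s s₀ : ℝ} (hs : s₀ ≤ s) {k : d → ℤ} (hk : k ≠ 0) :
    heatCoeff s k ≤ Real.exp (-(4 * Real.pi ^ 2 * (s - s₀))) * heatCoeff s₀ k := by
  rw [heatCoeff, heatCoeff, ← Real.exp_add, Real.exp_le_exp]
  have h1 := one_le_freqNormSq_of_ne_zero hk
  have hπ : 0 < 4 * Real.pi ^ 2 := by positivity
  have : 0 ≤ 4 * Real.pi ^ 2 * ((s - s₀) * (freqNormSq k - 1)) := by
    have : 0 ≤ (s - s₀) * (freqNormSq k - 1) := mul_nonneg (by linarith) (by linarith)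
    positivity
  nlinarith

/-! ### The integral `∫₀^∞ (1 − e^{-ρs}) s^{-3/2} ds = 2 √π √ρ` -/

omit [Fintype d] in
/-- `1 − e^{-ρs} = ∫₀^ρ s e^{-rs} dr` (fundamental theorem of calculus in `r`). [folklore] -/
private theorem integral_mul_exp_neg_mul_eq (ρ s : ℝ) :
    ∫ r in (0 : ℝ)..ρ, s * Real.exp (-r * s) = 1 - Real.exp (-ρ * s) := by
  have hderiv : ∀ r ∈ uIcc (0 : ℝ) ρ,
      HasDerivAt (fun r : ℝ => -Real.exp (-r * s)) (s * Real.exp (-r * s)) r := by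
    intro r _
    have h1 : HasDerivAt (fun r : ℝ => -r * s) (-s) r := by
      simpa using ((hasDerivAt_id r).neg.mul_const s)
    have h2 := (Real.hasDerivAt_exp (-r * s)).comp r h1
    exact h2.neg.congr_deriv (by ring)
  have hint : IntervalIntegrable (fun r : ℝ => s * Real.exp (-r * s)) volume 0 ρ :=
    (continuous_const.mul (Real.continuous_exp.comp
      (continuous_neg.mul continuous_const))).intervalIntegrable _ _
  rw [intervalIntegral.integral_eq_sub_of_hasDerivAt hderiv hint]
  simp only [neg_mul, zero_mul, neg_zero, Real.exp_zero]
  ring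

omit [Fintype d] in
/-- For `s > 0`: `(1 − e^{-ρs}) s^{-3/2} = ∫_{(0,ρ]} s^{-1/2} e^{-rs} dr` as an `ℝ≥0∞`-valued
integral. [folklore] -/
private theorem ofReal_one_sub_exp_mul_rpow_eq_lintegral {ρ : ℝ} (hρ : 0 < ρ) {s : ℝ} (hs : 0 < s) :
    ENNReal.ofReal ((1 - Real.exp (-ρ * s)) * s ^ (-(3 / 2 : ℝ))) =
      ∫⁻ r in Ioc (0 : ℝ) ρ, ENNReal.ofReal (s ^ (-(1 / 2 : ℝ)) * Real.exp (-r * s)) := by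
  have hcont : Continuous fun r : ℝ => s ^ (-(1 / 2 : ℝ)) * Real.exp (-r * s) :=
    continuous_const.mul (Real.continuous_exp.comp (continuous_neg.mul continuous_const))
  have hint : IntegrableOn (fun r : ℝ => s ^ (-(1 / 2 : ℝ)) * Real.exp (-r * s)) (Ioc 0 ρ) volume :=
    hcont.integrableOn_Ioc
  have hnn : 0 ≤ᵐ[volume.restrict (Ioc (0 : ℝ) ρ)]
      fun r : ℝ => s ^ (-(1 / 2 : ℝ)) * Real.exp (-r * s) :=
    ae_of_all _ fun r => mul_nonneg (Real.rpow_nonneg hs.le _) (Real.exp_pos _).le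
  rw [← ofReal_integral_eq_lintegral_ofReal hint hnn]
  congr 1
  -- `∫_{(0,ρ]} s^{-1/2} e^{-rs} dr = s^{-1/2} · s⁻¹ · (1 − e^{-ρs})`? No: pull out `s^{-3/2}` after
  -- writing `s^{-1/2} = s^{-3/2} · s`.
  have hsplit : ∀ r : ℝ, s ^ (-(1 / 2 : ℝ)) * Real.exp (-r * s) =
      s ^ (-(3 / 2 : ℝ)) * (s * Real.exp (-r * s)) := by
    intro r
    have : s ^ (-(1 / 2 : ℝ)) = s ^ (-(3 / 2 : ℝ)) * s := by
      rw [show (-(1 / 2 : ℝ)) = -(3 / 2 : ℝ) + 1 by norm_num, Real.rpow_add hs, Real.rpow_one]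
    rw [this]; ring
  simp_rw [hsplit]
  rw [integral_const_mul, ← intervalIntegral.integral_of_le hρ.le, integral_mul_exp_neg_mul_eq ρ s]
  ring

omit [Fintype d] in
/-- The Gamma integral `∫₀^∞ s^{-1/2} e^{-rs} ds = √π · r^{-1/2}` (`r > 0`) as an `ℝ≥0∞`-valued
integral (`integral_rpow_mul_exp_neg_mul_rpow`, `Γ(1/2) = √π`). [folklore] -/
private theorem lintegral_rpow_neg_half_mul_exp_neg_mul {r : ℝ} (hr : 0 < r) :
    ∫⁻ s in Ioi (0 : ℝ), ENNReal.ofReal (s ^ (-(1 / 2 : ℝ)) * Real.exp (-r * s)) =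
      ENNReal.ofReal (Real.sqrt π * r ^ (-(1 / 2 : ℝ))) := by
  have hq : (-1 : ℝ) < -(1 / 2 : ℝ) := by norm_num
  have hint := integrableOn_rpow_mul_exp_neg_mul_rpow hq (le_refl (1 : ℝ)) hr
  have hval := integral_rpow_mul_exp_neg_mul_rpow (zero_lt_one) hq hr
  simp only [Real.rpow_one] at hint hval
  have hnn : 0 ≤ᵐ[volume.restrict (Ioi (0 : ℝ))]
      fun s : ℝ => s ^ (-(1 / 2 : ℝ)) * Real.exp (-r * s) := by
    filter_upwards [ae_restrict_mem measurableSet_Ioi] with s hs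
    exact mul_nonneg (Real.rpow_nonneg (le_of_lt hs) _) (Real.exp_pos _).le
  rw [← ofReal_integral_eq_lintegral_ofReal hint hnn, hval, Real.Gamma_one_half_eq.symm]
  congr 1
  norm_num
  ring

omit [Fintype d] in
/-- **`∫₀^∞ (1 − e^{-ρs}) s^{-3/2} ds = 2 √π √ρ`** for `ρ > 0`, as an `ℝ≥0∞`-valued integral:
write `1 − e^{-ρs} = ∫₀^ρ s e^{-rs} dr`, swap the integrals (Tonelli), evaluate the Gamma
integral `∫₀^∞ s^{-1/2} e^{-rs} ds = √π r^{-1/2}` and `∫₀^ρ r^{-1/2} dr = 2ρ^{1/2}`. [folklore] -/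
private theorem lintegral_one_sub_exp_mul_rpow_neg_three_halves {ρ : ℝ} (hρ : 0 < ρ) :
    ∫⁻ s in Ioi (0 : ℝ), ENNReal.ofReal ((1 - Real.exp (-ρ * s)) * s ^ (-(3 / 2 : ℝ))) =
      ENNReal.ofReal (2 * Real.sqrt π * Real.sqrt ρ) := by
  set F : ℝ → ℝ → ℝ≥0∞ := fun s r => ENNReal.ofReal (s ^ (-(1 / 2 : ℝ)) * Real.exp (-r * s))
    with hF
  have hFm : Measurable (Function.uncurry F) := by
    refine Measurable.ennreal_ofReal ?_
    exact (measurable_fst.pow_const _).mul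
      (Real.measurable_exp.comp (measurable_snd.neg.mul measurable_fst))
  calc ∫⁻ s in Ioi (0 : ℝ), ENNReal.ofReal ((1 - Real.exp (-ρ * s)) * s ^ (-(3 / 2 : ℝ)))
      = ∫⁻ s in Ioi (0 : ℝ), ∫⁻ r in Ioc (0 : ℝ) ρ, F s r :=
        setLIntegral_congr_fun measurableSet_Ioi fun s hs =>
          ofReal_one_sub_exp_mul_rpow_eq_lintegral hρ hs
    _ = ∫⁻ r in Ioc (0 : ℝ) ρ, ∫⁻ s in Ioi (0 : ℝ), F s r :=
        lintegral_lintegral_swap hFm.aemeasurable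
    _ = ∫⁻ r in Ioc (0 : ℝ) ρ, ENNReal.ofReal (Real.sqrt π * r ^ (-(1 / 2 : ℝ))) :=
        setLIntegral_congr_fun measurableSet_Ioc fun r hr =>
          lintegral_rpow_neg_half_mul_exp_neg_mul hr.1
    _ = ENNReal.ofReal (Real.sqrt π) * ∫⁻ r in Ioc (0 : ℝ) ρ, ENNReal.ofReal (r ^ (-(1 / 2 : ℝ))) := by
        rw [← lintegral_const_mul' _ _ ENNReal.ofReal_ne_top]
        refine lintegral_congr fun r => ?_
        rw [← ENNReal.ofReal_mul (Real.sqrt_nonneg _)]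
    _ = ENNReal.ofReal (2 * Real.sqrt π * Real.sqrt ρ) := by
        rw [lintegral_Ioc_rpow_neg_half hρ, ← ENNReal.ofReal_mul (Real.sqrt_nonneg _),
          Real.sqrt_eq_rpow ρ]
        congr 1
        ring


/-! ### Two closed forms -/

omit [Fintype d] in
/-- `(4π)^{-3/2} · 2√π = 1/(4π)`. [folklore] -/
private theorem four_pi_rpow_neg_three_halves_mul :
    (4 * π) ^ (-(3 / 2 : ℝ)) * (2 * Real.sqrt π) = 1 / (4 * π) := by
  have h4π : 0 < 4 * π := by positivity
  have hs : Real.sqrt (4 * π) = 2 * Real.sqrt π := by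
    rw [Real.sqrt_mul' 4 Real.pi_pos.le, show (4 : ℝ) = 2 ^ 2 by norm_num,
      Real.sqrt_sq (by norm_num : (0:ℝ) ≤ 2)]
  have h32 : (4 * π) ^ ((3 / 2 : ℝ)) = (4 * π) * (2 * Real.sqrt π) := by
    rw [show (3 / 2 : ℝ) = 1 + 1 / 2 by norm_num, Real.rpow_add h4π, Real.rpow_one,
      ← Real.sqrt_eq_rpow, hs]
  rw [Real.rpow_neg h4π.le, h32]
  have hπ : 0 < Real.sqrt π := Real.sqrt_pos.2 Real.pi_pos
  field_simp

omit [Fintype d] in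
/-- `(4π · (π/64))^{-3/2} = 64/π³`. [folklore] -/
private theorem four_pi_mul_s0_rpow_neg_three_halves :
    (4 * π * (π / 64)) ^ (-(3 / 2 : ℝ)) = 64 / π ^ 3 := by
  have hπ : 0 < π := Real.pi_pos
  have h1 : 4 * π * (π / 64) = (π / 4) ^ 2 := by ring
  rw [h1, show ((π / 4) ^ 2 : ℝ) = (π / 4) ^ (2 : ℝ) by norm_cast, ← Real.rpow_mul (by positivity),
    show (2 : ℝ) * -(3 / 2 : ℝ) = -(3 : ℝ) by norm_num, Real.rpow_neg (by positivity),
    show (3 : ℝ) = ((3 : ℕ) : ℝ) by norm_num, Real.rpow_natCast]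
  field_simp
  norm_num

/-! ### The explicit bound -/

/-- **The lattice sum of Agmon's inequality on a three-dimensional torus, explicit constant.**
On `ℤ^d` with `card d = 3`, for every `ρ ≥ 4π²`,
`∑_{k ≠ 0} ρ / (μₖ(μₖ + ρ)) ≤ ρ^{1/2}/π²`, `μₖ = 4π²|k|²`. Proof:
`ρ/(μ(μ+ρ)) = ∫₀^∞ e^{-μs}(1−e^{-ρs}) ds`, Tonelli, then on `(0, π/64]` the Jacobi bound
`Θ(s) ≤ Z₀³ (4πs)^{-3/2}` with `∫₀^∞ (1−e^{-ρs}) s^{-3/2} ds = 2√π ρ^{1/2}`, and on `(π/64, ∞)` the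
exponential decay `Θ(s) − 1 ≤ e^{-4π²(s−π/64)} Z₀³ 64/π³`; finally `Z₀ ≤ 149/147` and
`ρ^{1/2} ≥ 2π`. (The integral over `ℝ³` in place of the lattice sum gives `ρ^{1/2}/(4π)`; the
constant `1/π²` is the one implicit in Ayala 2014, App. A (A.1)–(A.3), where the lattice sums are
replaced by integrals.) [cite: ConstantinFoias1988, Ch. 4; Ayala2014Thesis, App. A (A.1)–(A.3)] -/
theorem tsum_agmonWeight_le_sqrt_div_pi_sq (hd : Fintype.card d = 3) {ρ : ℝ}
    (hρ : 4 * π ^ 2 ≤ ρ) :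
    ∑' k : d → ℤ, (if k = 0 then (0 : ℝ) else
      ρ / (4 * π ^ 2 * freqNormSq k * (4 * π ^ 2 * freqNormSq k + ρ))) ≤ Real.sqrt ρ / π ^ 2 := by
  classical
  haveI : Nonempty d := by
    rw [← Fintype.card_pos_iff, hd]; norm_num
  have hπ : 0 < π := Real.pi_pos
  have hρ0 : 0 < ρ := lt_of_lt_of_le (by positivity) hρ
  -- ### the constants
  set s₀ : ℝ := π / 64 with hs₀_def
  have hs₀ : 0 < s₀ := by positivity
  set Z₀ : ℝ := ∑' n : ℤ, Real.exp (-((n : ℝ) ^ 2 / (4 * s₀))) with hZ₀_def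
  have hZ₀le : Z₀ ≤ 149 / 147 := tsum_int_exp_neg_sq_div_le
  have hZ₀0 : 0 ≤ Z₀ := tsum_nonneg fun n => (Real.exp_pos _).le
  set K : ℝ := Z₀ ^ 3 * (4 * π) ^ (-(3 / 2 : ℝ)) with hK_def
  have hK0 : 0 ≤ K := by positivity
  set M : ℝ := Z₀ ^ 3 * (64 / π ^ 3) with hM_def
  have hM0 : 0 ≤ M := by positivity
  -- ### the summand and its summability
  set a : (d → ℤ) → ℝ := fun k => if k = 0 then (0 : ℝ) else
    ρ / (4 * π ^ 2 * freqNormSq k * (4 * π ^ 2 * freqNormSq k + ρ)) with ha_def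
  have ha0 : ∀ k, 0 ≤ a k := fun k => by
    simp only [ha_def]
    split_ifs
    · exact le_rfl
    · have := freqNormSq_nonneg k
      positivity
  have has : Summable a := summable_agmonWeight hd.le hρ0
  -- ### the weights as time integrals, in `ℝ≥0∞`
  set G : (d → ℤ) → ℝ → ℝ≥0∞ := fun k s => if k = 0 then 0 else
    ENNReal.ofReal (Real.exp (-(4 * π ^ 2 * freqNormSq k) * s) * (1 - Real.exp (-ρ * s))) with hG_def
  have hGk : ∀ k, ENNReal.ofReal (a k) = ∫⁻ s in Ioi (0 : ℝ), G k s := by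
    intro k
    by_cases hk : k = 0
    · simp [ha_def, hG_def, hk]
    · have hμ : 0 < 4 * π ^ 2 * freqNormSq k := by
        have := one_le_freqNormSq_of_ne_zero hk; positivity
      simp only [ha_def, hG_def, if_neg hk]
      have hint : IntegrableOn (fun s : ℝ => Real.exp (-(4 * π ^ 2 * freqNormSq k) * s) *
          (1 - Real.exp (-ρ * s))) (Ioi 0) volume := by
        have h1 := integrableOn_exp_mul_Ioi (by linarith : -(4 * π ^ 2 * freqNormSq k) < 0) 0
        have h2 := integrableOn_exp_mul_Ioi (by linarith : -(4 * π ^ 2 * freqNormSq k + ρ) < 0) 0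
        refine (h1.sub h2).congr_fun (fun s _ => ?_) measurableSet_Ioi
        rw [Pi.sub_apply, mul_sub, mul_one, ← Real.exp_add]
        congr 2
        ring
      have hnn : 0 ≤ᵐ[volume.restrict (Ioi (0 : ℝ))] fun s : ℝ =>
          Real.exp (-(4 * π ^ 2 * freqNormSq k) * s) * (1 - Real.exp (-ρ * s)) := by
        filter_upwards [ae_restrict_mem measurableSet_Ioi] with s hs
        exact exp_neg_mul_one_sub_exp_nonneg hρ0.le (le_of_lt hs)
      rw [← ofReal_integral_eq_lintegral_ofReal hint hnn, integral_exp_neg_mul_one_sub_exp hμ hρ0]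
      congr 1
      have hf0 : freqNormSq k ≠ 0 := by
        have := one_le_freqNormSq_of_ne_zero hk; linarith
      have hμρ0 : 4 * π ^ 2 * freqNormSq k + ρ ≠ 0 := by linarith
      have hπ0 : (π : ℝ) ≠ 0 := Real.pi_ne_zero
      field_simp
      ring
  -- ### Tonelli
  have hGmeas : ∀ k, Measurable (G k) := by
    intro k
    by_cases hk : k = 0
    · simp only [hG_def, if_pos hk]
      exact measurable_const
    · simp only [hG_def, if_neg hk]
      exact ((Real.continuous_exp.comp (continuous_const.mul continuous_id)).mul
        (continuous_const.sub (Real.continuous_exp.comp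
          (continuous_const.mul continuous_id)))).measurable.ennreal_ofReal
  have hT : ∑' k, ∫⁻ s in Ioi (0 : ℝ), G k s = ∫⁻ s in Ioi (0 : ℝ), ∑' k, G k s :=
    (lintegral_tsum fun k => (hGmeas k).aemeasurable).symm
  -- ### the integrand: `∑ₖ G k s = (1 − e^{-ρs}) · T(s)`, `T(s) = ∑_{k ≠ 0} e^{-4π²|k|²s}`
  set T : ℝ → ℝ≥0∞ := fun s => ∑' k : d → ℤ,
    (if k = 0 then (0 : ℝ≥0∞) else ENNReal.ofReal (heatCoeff s k)) with hT_def
  have hsum_s : ∀ s : ℝ, 0 < s → ∑' k, G k s = ENNReal.ofReal (1 - Real.exp (-ρ * s)) * T s := by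
    intro s hs
    have h1s : 0 ≤ 1 - Real.exp (-ρ * s) := by
      rw [sub_nonneg, Real.exp_le_one_iff]; nlinarith
    have hGs : ∀ k, G k s = ENNReal.ofReal (1 - Real.exp (-ρ * s)) *
        (if k = 0 then (0 : ℝ≥0∞) else ENNReal.ofReal (heatCoeff s k)) := by
      intro k
      by_cases hk : k = 0
      · simp [hG_def, hk]
      · simp only [hG_def, if_neg hk, heatCoeff_apply]
        rw [mul_comm (Real.exp _), ENNReal.ofReal_mul h1s]
        congr 2
        ring
    rw [tsum_congr hGs, ENNReal.tsum_mul_left]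
  -- ### `T(s) ≤ Θ(s)` and the small-time bound `T(s) ≤ Z₀³ (4πs)^{-3/2}` for `s ≤ s₀`
  have hTle : ∀ s : ℝ, 0 < s → T s ≤ ENNReal.ofReal (∑' k : d → ℤ, heatCoeff s k) := by
    intro s hs
    rw [ENNReal.ofReal_tsum_of_nonneg (fun k => (heatCoeff_pos s k).le) (summable_heatCoeff hs)]
    refine ENNReal.tsum_le_tsum fun k => ?_
    split_ifs
    · exact bot_le
    · exact le_rfl
  have hsmall : ∀ s : ℝ, 0 < s → s ≤ s₀ →
      T s ≤ ENNReal.ofReal (K * s ^ (-(3 / 2 : ℝ))) := by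
    intro s hs hss
    refine (hTle s hs).trans (ENNReal.ofReal_le_ofReal ?_)
    have h := tsum_heatCoeff_le_rpow_of_le (d := d) hs hss
    rw [hd] at h
    have hsplit : (4 * π * s) ^ (-(((3 : ℕ) : ℝ) / 2)) =
        (4 * π) ^ (-(3 / 2 : ℝ)) * s ^ (-(3 / 2 : ℝ)) := by
      rw [show (-(((3 : ℕ) : ℝ) / 2)) = -(3 / 2 : ℝ) by norm_num]
      exact Real.mul_rpow (by positivity) hs.le
    rw [hsplit, ← mul_assoc] at h
    exact h
  -- ### the large-time bound `T(s) ≤ e^{-4π²(s−s₀)} M` for `s ≥ s₀`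
  have hTs₀ : T s₀ ≤ ENNReal.ofReal M := by
    refine (hsmall s₀ hs₀ le_rfl).trans (le_of_eq ?_)
    congr 1
    rw [hK_def, hM_def, mul_assoc, ← Real.mul_rpow (by positivity) hs₀.le,
      four_pi_mul_s0_rpow_neg_three_halves]
  have hlarge : ∀ s : ℝ, s₀ ≤ s →
      T s ≤ ENNReal.ofReal (Real.exp (-(4 * π ^ 2 * (s - s₀)))) * ENNReal.ofReal M := by
    intro s hss
    have hcmp : T s ≤ ENNReal.ofReal (Real.exp (-(4 * π ^ 2 * (s - s₀)))) * T s₀ := by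
      rw [hT_def, ← ENNReal.tsum_mul_left]
      refine ENNReal.tsum_le_tsum fun k => ?_
      split_ifs with hk
      · simp
      · rw [← ENNReal.ofReal_mul (Real.exp_pos _).le]
        exact ENNReal.ofReal_le_ofReal (heatCoeff_le_exp_mul_of_le hss hk)
    exact hcmp.trans (mul_le_mul' le_rfl hTs₀)
  -- ### pointwise bounds of the integrand on the two pieces
  have hpiece1 : ∀ s ∈ Ioc (0 : ℝ) s₀,
      ENNReal.ofReal (1 - Real.exp (-ρ * s)) * T s ≤
        ENNReal.ofReal K * ENNReal.ofReal ((1 - Real.exp (-ρ * s)) * s ^ (-(3 / 2 : ℝ))) := by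
    intro s hs
    have h1s : 0 ≤ 1 - Real.exp (-ρ * s) := by
      rw [sub_nonneg, Real.exp_le_one_iff]; nlinarith [hs.1]
    calc ENNReal.ofReal (1 - Real.exp (-ρ * s)) * T s
        ≤ ENNReal.ofReal (1 - Real.exp (-ρ * s)) * ENNReal.ofReal (K * s ^ (-(3 / 2 : ℝ))) :=
          mul_le_mul' le_rfl (hsmall s hs.1 hs.2)
      _ = ENNReal.ofReal K * ENNReal.ofReal ((1 - Real.exp (-ρ * s)) * s ^ (-(3 / 2 : ℝ))) := by
          rw [← ENNReal.ofReal_mul h1s, ← ENNReal.ofReal_mul hK0,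
            show (1 - Real.exp (-ρ * s)) * (K * s ^ (-(3 / 2 : ℝ))) =
              K * ((1 - Real.exp (-ρ * s)) * s ^ (-(3 / 2 : ℝ))) by ring]
  have hpiece2 : ∀ s ∈ Ioi s₀,
      ENNReal.ofReal (1 - Real.exp (-ρ * s)) * T s ≤
        ENNReal.ofReal M * ENNReal.ofReal (Real.exp (-(4 * π ^ 2) * s + 4 * π ^ 2 * s₀)) := by
    intro s hs
    have hs0 : 0 < s := hs₀.trans hs
    have h1s1 : ENNReal.ofReal (1 - Real.exp (-ρ * s)) ≤ 1 := by
      rw [← ENNReal.ofReal_one]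
      exact ENNReal.ofReal_le_ofReal (by linarith [Real.exp_pos (-ρ * s)])
    calc ENNReal.ofReal (1 - Real.exp (-ρ * s)) * T s
        ≤ 1 * (ENNReal.ofReal (Real.exp (-(4 * π ^ 2 * (s - s₀)))) * ENNReal.ofReal M) :=
          mul_le_mul' h1s1 (hlarge s (le_of_lt hs))
      _ = ENNReal.ofReal M * ENNReal.ofReal (Real.exp (-(4 * π ^ 2) * s + 4 * π ^ 2 * s₀)) := by
          rw [one_mul, mul_comm]
          congr 2
          ring
  -- ### the two integrals
  have hI1 : ∫⁻ s in Ioc (0 : ℝ) s₀, ENNReal.ofReal (1 - Real.exp (-ρ * s)) * T s ≤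
      ENNReal.ofReal (K * (2 * Real.sqrt π * Real.sqrt ρ)) := by
    calc ∫⁻ s in Ioc (0 : ℝ) s₀, ENNReal.ofReal (1 - Real.exp (-ρ * s)) * T s
        ≤ ∫⁻ s in Ioc (0 : ℝ) s₀, ENNReal.ofReal K *
            ENNReal.ofReal ((1 - Real.exp (-ρ * s)) * s ^ (-(3 / 2 : ℝ))) :=
          setLIntegral_mono' measurableSet_Ioc hpiece1
      _ ≤ ∫⁻ s in Ioi (0 : ℝ), ENNReal.ofReal K *
            ENNReal.ofReal ((1 - Real.exp (-ρ * s)) * s ^ (-(3 / 2 : ℝ))) :=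
          lintegral_mono_set Ioc_subset_Ioi_self
      _ = ENNReal.ofReal K * ENNReal.ofReal (2 * Real.sqrt π * Real.sqrt ρ) := by
          rw [lintegral_const_mul' _ _ ENNReal.ofReal_ne_top,
            lintegral_one_sub_exp_mul_rpow_neg_three_halves hρ0]
      _ = ENNReal.ofReal (K * (2 * Real.sqrt π * Real.sqrt ρ)) := by
          rw [← ENNReal.ofReal_mul hK0]
  have hI2 : ∫⁻ s in Ioi s₀, ENNReal.ofReal (1 - Real.exp (-ρ * s)) * T s ≤
      ENNReal.ofReal (M * (1 / (4 * π ^ 2))) := by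
    have h4 : -(4 * π ^ 2) < 0 := by
      have : 0 < 4 * π ^ 2 := by positivity
      linarith
    have hint : IntegrableOn (fun s : ℝ => Real.exp (-(4 * π ^ 2) * s + 4 * π ^ 2 * s₀)) (Ioi s₀)
        volume := by
      have h1 : IntegrableOn (fun s : ℝ => Real.exp (-(4 * π ^ 2) * s) * Real.exp (4 * π ^ 2 * s₀))
          (Ioi s₀) volume :=
        (integrableOn_exp_mul_Ioi h4 s₀).mul_const (Real.exp (4 * π ^ 2 * s₀))
      refine h1.congr_fun (fun s _ => ?_) measurableSet_Ioi
      exact (Real.exp_add _ _).symm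
    have hnn : 0 ≤ᵐ[volume.restrict (Ioi s₀)] fun s : ℝ =>
        Real.exp (-(4 * π ^ 2) * s + 4 * π ^ 2 * s₀) := ae_of_all _ fun s => (Real.exp_pos _).le
    have hval : ∫ s in Ioi s₀, Real.exp (-(4 * π ^ 2) * s + 4 * π ^ 2 * s₀) = 1 / (4 * π ^ 2) := by
      have e1 : (fun s : ℝ => Real.exp (-(4 * π ^ 2) * s + 4 * π ^ 2 * s₀)) =
          fun s => Real.exp (-(4 * π ^ 2) * s) * Real.exp (4 * π ^ 2 * s₀) := by
        funext s; rw [← Real.exp_add]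
      rw [e1, integral_mul_const, integral_exp_mul_Ioi h4 s₀]
      rw [show -(4 * π ^ 2) * s₀ = -(4 * π ^ 2 * s₀) by ring, Real.exp_neg]
      have hE : Real.exp (4 * π ^ 2 * s₀) ≠ 0 := (Real.exp_pos _).ne'
      field_simp
    calc ∫⁻ s in Ioi s₀, ENNReal.ofReal (1 - Real.exp (-ρ * s)) * T s
        ≤ ∫⁻ s in Ioi s₀, ENNReal.ofReal M *
            ENNReal.ofReal (Real.exp (-(4 * π ^ 2) * s + 4 * π ^ 2 * s₀)) :=
          setLIntegral_mono' measurableSet_Ioi hpiece2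
      _ = ENNReal.ofReal M * ENNReal.ofReal (1 / (4 * π ^ 2)) := by
          rw [lintegral_const_mul' _ _ ENNReal.ofReal_ne_top,
            ← ofReal_integral_eq_lintegral_ofReal hint hnn, hval]
      _ = ENNReal.ofReal (M * (1 / (4 * π ^ 2))) := by rw [← ENNReal.ofReal_mul hM0]
  -- ### assembling
  have hI : ∫⁻ s in Ioi (0 : ℝ), ∑' k, G k s ≤
      ENNReal.ofReal (K * (2 * Real.sqrt π * Real.sqrt ρ) + M * (1 / (4 * π ^ 2))) := by
    calc ∫⁻ s in Ioi (0 : ℝ), ∑' k, G k s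
        = ∫⁻ s in Ioi (0 : ℝ), ENNReal.ofReal (1 - Real.exp (-ρ * s)) * T s :=
          setLIntegral_congr_fun measurableSet_Ioi fun s hs => hsum_s s hs
      _ = ∫⁻ s in Ioc (0 : ℝ) s₀ ∪ Ioi s₀, ENNReal.ofReal (1 - Real.exp (-ρ * s)) * T s := by
          rw [Ioc_union_Ioi_eq_Ioi hs₀.le]
      _ ≤ (∫⁻ s in Ioc (0 : ℝ) s₀, ENNReal.ofReal (1 - Real.exp (-ρ * s)) * T s) +
            ∫⁻ s in Ioi s₀, ENNReal.ofReal (1 - Real.exp (-ρ * s)) * T s :=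
          lintegral_union_le _ _ _
      _ ≤ ENNReal.ofReal (K * (2 * Real.sqrt π * Real.sqrt ρ)) +
            ENNReal.ofReal (M * (1 / (4 * π ^ 2))) := add_le_add hI1 hI2
      _ = ENNReal.ofReal (K * (2 * Real.sqrt π * Real.sqrt ρ) + M * (1 / (4 * π ^ 2))) := by
          rw [← ENNReal.ofReal_add (by positivity) (by positivity)]
  -- ### back to the real sum
  have hfin : ENNReal.ofReal (∑' k, a k) ≤
      ENNReal.ofReal (K * (2 * Real.sqrt π * Real.sqrt ρ) + M * (1 / (4 * π ^ 2))) := by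
    rw [ENNReal.ofReal_tsum_of_nonneg ha0 has, tsum_congr hGk, hT]
    exact hI
  have hreal : ∑' k, a k ≤ K * (2 * Real.sqrt π * Real.sqrt ρ) + M * (1 / (4 * π ^ 2)) :=
    (ENNReal.ofReal_le_ofReal_iff (by positivity)).1 hfin
  -- ### numerics: `Z₀³ (√ρ/(4π) + 16/π⁵) ≤ √ρ/π²` for `√ρ ≥ 2π`, `Z₀ ≤ 149/147`
  refine hreal.trans ?_
  have hKid : K * (2 * Real.sqrt π * Real.sqrt ρ) = Z₀ ^ 3 * (Real.sqrt ρ / (4 * π)) := by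
    rw [hK_def, mul_assoc, ← mul_assoc ((4 * π) ^ (-(3 / 2 : ℝ))), four_pi_rpow_neg_three_halves_mul]
    ring
  rw [hKid, hM_def]
  have ht : 2 * π ≤ Real.sqrt ρ := by
    rw [show 2 * π = Real.sqrt ((2 * π) ^ 2) by rw [Real.sqrt_sq (by positivity)]]
    exact Real.sqrt_le_sqrt (by nlinarith)
  set t : ℝ := Real.sqrt ρ with ht_def
  have hZ3 : Z₀ ^ 3 ≤ (149 / 147 : ℝ) ^ 3 := pow_le_pow_left₀ hZ₀0 hZ₀le 3
  have hZ30 : 0 ≤ Z₀ ^ 3 := by positivity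
  have hπlo : 3.14159 < π := by linarith [Real.pi_gt_d6]
  have hπhi : π < 3.1416 := by linarith [Real.pi_lt_d4]
  have hπ3 : 31 < π ^ 3 := by nlinarith
  have hπ4 : π ^ 4 < 97.42 := by nlinarith
  -- clear denominators: the claim is `Z₀³ (π⁴ t + 64) ≤ 4 π³ t`
  have hmain : Z₀ ^ 3 * (π ^ 4 * t + 64) ≤ 4 * π ^ 3 * t := by
    have h1 : Z₀ ^ 3 * (π ^ 4 * t + 64) ≤ (149 / 147 : ℝ) ^ 3 * (π ^ 4 * t + 64) :=
      mul_le_mul_of_nonneg_right hZ3 (by positivity)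
    refine h1.trans ?_
    nlinarith
  have h4π5 : 0 < 4 * π ^ 5 := by positivity
  refine le_of_mul_le_mul_right ?_ h4π5
  have eL : (Z₀ ^ 3 * (t / (4 * π)) + Z₀ ^ 3 * (64 / π ^ 3) * (1 / (4 * π ^ 2))) * (4 * π ^ 5) =
      Z₀ ^ 3 * (π ^ 4 * t + 64) := by
    field_simp
  have eR : t / π ^ 2 * (4 * π ^ 5) = 4 * π ^ 3 * t := by
    field_simp
  rw [eL, eR]
  exact hmain

end Torus

end Literature.Analysis.FunctionSpaces

end
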